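import Summits.QuantumFields.YangMills.Theorems.ColdStartUniversalityLatticeLangevinTimeDecorrelation
import HarnessLib

/-!
# Route `ColdStartUniversality` (fixed-cut-off SZZ dynamics): ★★★ ERGODIC THEOREMS FOR THE DISCRETELY SAMPLED COLD-START LANGEVIN CHAIN —
# `N⁻¹ Σ_(k<N) G(U_(kh)) → ∫ G dμ_(β')` in mean square (rate `1/N`) and almost surely, every step `h > 0`, every coupling, every realisation

Helper file (seat `ym-line-csu-p1`, g33; `--supports stmt-QuantumFields-24809`).  What a simulation actually computes is the average of an observable
over EQUALLY SPACED SAMPLES `U_h, U_(2h), …` of one run.  From the time-like decorrelation of file 48 (`abs_twoTime_centered_le_exp`: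
`|E[F(U_s)(G(U_(s+t)) − μG)]| ≤ Ce^(−ct)`), for EVERY strong solution of the SU(2) SZZ dynamics from a deterministic start on ANY probability space
(no joint-measurability issue: finite sums), every bounded measurable `G` with `|G| ≤ 1`, every step `h > 0`:
* ★★ `integral_sq_sum_le_of_twoTime` / `ae_tendsto_average_zero_of_sq_le` — generic: a bounded sequence of random variables with
  `|E[g_j g_k]| ≤ K r^(k−j)` (`0 ≤ r < 1`) has `E[(Σ_(k<N) g_k)²] ≤ N·(B² + 2Kr/(1−r))` (induction on `N`, one geometric sum), and a bounded sequence with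
  `E[(N⁻¹Σ_(k<N) g_k)²] ≤ D/N` has `N⁻¹Σ_(k<N) g_k → 0` a.s. (summable variances along `N = n²`, `E Σ < ∞ ⇒ Σ < ∞` a.s., interpolation);
* ★★★ `integral_sq_average_sub_wilson_le` — `E[(N⁻¹ Σ_(k<N) G(U_(kh)) − μ_(β')(G))²] ≤ (4 + 4C·e^(−ch)/(1 − e^(−ch)))/N`;
* ★★★ `ae_tendsto_average_wilson` — `N⁻¹ Σ_(k<N) G(U_(kh)) → ∫ G dμ_(β')` ALMOST SURELY.
Constants `C, c > 0` depend on `L, β'` (Harris at fixed cut-off).  THEOREMS ONLY, no definition, no sorry; [folklore].  HONEST FRAMING: fixed cut-off;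
`UniformColdStartMixing` (24809) is NOT restated; no crux, rung or summit statement is proved; the Yang–Mills mass gap is NOT proved.
-/

set_option autoImplicit false

noncomputable section

namespace Summit.QuantumFields.YangMills.Theorems.ColdStartUniversality

open MeasureTheory ProbabilityTheory Filter Topology
open scoped NNReal ENNReal BigOperators
open Literature Literature.Probability.Process Literature.MathematicalPhysics.QuantumFieldTheory
open Literature.MathematicalPhysics.QuantumLattice (fundamentalRep fundamentalLatticeRep continuous_fundamentalRep)

/-! ## §1. Generic: variance of sums with geometrically decaying two-time products -/

/-- ★★ **Variance of partial sums.**  If `g_k` are measurable with `|g_k| ≤ B` and `|E[g_j·g_k]| ≤ K·r^(k−j)` for `j ≤ k` (`K ≥ 0`, `0 ≤ r < 1`),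
then `E[(Σ_(k<N) g_k)²] ≤ N·(B² + 2K·r/(1−r))` for every `N`. (Induction on `N`; the cross term `E[S_N g_N]` is a single geometric sum.)
[folklore] -/
theorem integral_sq_sum_le_of_twoTime {Ω : Type*} [MeasurableSpace Ω] {P : Measure Ω} [IsProbabilityMeasure P]
    {g : ℕ → Ω → ℝ} (hg : ∀ k, Measurable (g k)) {B : ℝ} (hB : ∀ k ω, |g k ω| ≤ B)
    {K r : ℝ} (hK : 0 ≤ K) (hr0 : 0 ≤ r) (hr1 : r < 1)
    (hdec : ∀ j k : ℕ, j ≤ k → |∫ ω, g j ω * g k ω ∂P| ≤ K * r ^ (k - j)) :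
    ∀ N : ℕ, ∫ ω, (∑ k ∈ Finset.range N, g k ω) ^ 2 ∂P ≤ N * (B ^ 2 + 2 * K * r / (1 - r))
  | 0 => by simp
  | N + 1 => by
    have ih := integral_sq_sum_le_of_twoTime hg hB hK hr0 hr1 hdec N
    have hB0 : ∀ ω, 0 ≤ B := fun ω => (abs_nonneg _).trans (hB 0 ω)
    -- integrability of the bounded pieces
    have hSm : ∀ n, Measurable fun ω => ∑ k ∈ Finset.range n, g k ω := fun n => Finset.measurable_sum _ fun k _ => hg k
    have hSb : ∀ n ω, |∑ k ∈ Finset.range n, g k ω| ≤ n * B := fun n ω =>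
      (Finset.abs_sum_le_sum_abs _ _).trans (by
        calc ∑ k ∈ Finset.range n, |g k ω| ≤ ∑ _k ∈ Finset.range n, B := Finset.sum_le_sum fun k _ => hB k ω
          _ = n * B := by rw [Finset.sum_const, Finset.card_range, nsmul_eq_mul])
    have hInt : ∀ {φ ψ : Ω → ℝ} {Cφ Cψ : ℝ}, Measurable φ → Measurable ψ → (∀ ω, |φ ω| ≤ Cφ) → (∀ ω, |ψ ω| ≤ Cψ) →
        Integrable (fun ω => φ ω * ψ ω) P := fun hφ hψ hφb hψb =>
      (integrable_const _).mono' (hφ.mul hψ).aestronglyMeasurable (Eventually.of_forall fun ω => by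
        rw [norm_mul, Real.norm_eq_abs, Real.norm_eq_abs]
        exact mul_le_mul (hφb ω) (hψb ω) (abs_nonneg _) ((abs_nonneg _).trans (hφb ω)))
    have i1 : Integrable (fun ω => (∑ k ∈ Finset.range N, g k ω) ^ 2) P := by
      simpa only [pow_two] using hInt (hSm N) (hSm N) (hSb N) (hSb N)
    have i2 : Integrable (fun ω => (∑ k ∈ Finset.range N, g k ω) * g N ω) P := hInt (hSm N) (hg N) (hSb N) (hB N)
    have i3 : Integrable (fun ω => g N ω * g N ω) P := hInt (hg N) (hg N) (hB N) (hB N)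
    have i2' : Integrable (fun ω => 2 * ((∑ k ∈ Finset.range N, g k ω) * g N ω)) P := i2.const_mul 2
    have i12 : Integrable (fun ω => (∑ k ∈ Finset.range N, g k ω) ^ 2 + 2 * ((∑ k ∈ Finset.range N, g k ω) * g N ω)) P := i1.add i2'
    -- expand the square
    have hexp : ∫ ω, (∑ k ∈ Finset.range (N + 1), g k ω) ^ 2 ∂P =
        (∫ ω, (∑ k ∈ Finset.range N, g k ω) ^ 2 ∂P) + 2 * (∫ ω, (∑ k ∈ Finset.range N, g k ω) * g N ω ∂P) + ∫ ω, g N ω * g N ω ∂P := by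
      have h1 : ∀ ω, (∑ k ∈ Finset.range (N + 1), g k ω) ^ 2 =
          (∑ k ∈ Finset.range N, g k ω) ^ 2 + 2 * ((∑ k ∈ Finset.range N, g k ω) * g N ω) + g N ω * g N ω := by
        intro ω; rw [Finset.sum_range_succ]; ring
      rw [integral_congr_ae (ae_of_all _ h1), integral_add i12 i3, integral_add i1 i2', integral_const_mul]
    -- the cross term: one geometric sum
    have hcross : |∫ ω, (∑ k ∈ Finset.range N, g k ω) * g N ω ∂P| ≤ K * r / (1 - r) := by
      have h1 : ∫ ω, (∑ k ∈ Finset.range N, g k ω) * g N ω ∂P = ∑ j ∈ Finset.range N, ∫ ω, g j ω * g N ω ∂P := by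
        rw [← integral_finsetSum _ (fun j _ => hInt (hg j) (hg N) (hB j) (hB N))]
        exact integral_congr_ae (ae_of_all _ fun ω => by simp only [Finset.sum_mul])
      rw [h1]
      refine (Finset.abs_sum_le_sum_abs _ _).trans ?_
      have h2 : ∑ j ∈ Finset.range N, |∫ ω, g j ω * g N ω ∂P| ≤ ∑ j ∈ Finset.range N, K * r ^ (N - j) :=
        Finset.sum_le_sum fun j hj => hdec j N (Finset.mem_range.1 hj).le
      refine h2.trans ?_
      -- `Σ_(j<N) r^(N−j) = r · Σ_(i<N) r^i ≤ r/(1−r)`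
      have h3 : ∑ j ∈ Finset.range N, K * r ^ (N - j) = K * (r * ∑ i ∈ Finset.range N, r ^ i) := by
        rw [Finset.mul_sum, Finset.mul_sum, ← Finset.sum_range_reflect (fun j => K * r ^ (N - j)) N]
        refine Finset.sum_congr rfl fun i hi => ?_
        have hi' := Finset.mem_range.1 hi
        rw [show N - (N - 1 - i) = i + 1 by omega, pow_succ]; ring
      rw [h3]
      have h4 : ∑ i ∈ Finset.range N, r ^ i ≤ (1 - r)⁻¹ :=
        sum_le_hasSum _ (fun i _ => pow_nonneg hr0 i) (hasSum_geometric_of_lt_one hr0 hr1)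
      calc K * (r * ∑ i ∈ Finset.range N, r ^ i) ≤ K * (r * (1 - r)⁻¹) :=
            mul_le_mul_of_nonneg_left (mul_le_mul_of_nonneg_left h4 hr0) hK
        _ = K * r / (1 - r) := by rw [div_eq_mul_inv, mul_assoc]
    have hdiag : ∫ ω, g N ω * g N ω ∂P ≤ B ^ 2 := by
      have hh := norm_integral_le_of_norm_le_const (μ := P) (f := fun ω => g N ω * g N ω) (C := B ^ 2)
        (Eventually.of_forall fun ω => by
          rw [norm_mul, Real.norm_eq_abs, pow_two]
          exact mul_le_mul (hB N ω) (hB N ω) (abs_nonneg _) (hB0 ω))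
      rw [Real.norm_eq_abs, probReal_univ, mul_one] at hh
      exact (le_abs_self _).trans hh
    rw [hexp]
    have hc2 := (abs_le.1 hcross).2
    have hD : (((N + 1 : ℕ) : ℝ)) * (B ^ 2 + 2 * K * r / (1 - r)) =
        (N : ℝ) * (B ^ 2 + 2 * K * r / (1 - r)) + 2 * (K * r / (1 - r)) + B ^ 2 := by push_cast; ring
    rw [hD]
    exact add_le_add (add_le_add ih (by linarith)) hdiag

/-! ## §2. Generic: mean-square rate `D/N` + bounded summands ⇒ almost-sure convergence of the averages -/

/-- ★★ **Almost-sure convergence of averages from a mean-square rate.**  If `g_k` are measurable with `|g_k| ≤ B` and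
`E[(N⁻¹ Σ_(k<N) g_k)²] ≤ D/N` for all `N ≥ 1`, then `N⁻¹ Σ_(k<N) g_k(ω) → 0` for almost every `ω`. [folklore] -/
theorem ae_tendsto_average_zero_of_sq_le {Ω : Type*} [MeasurableSpace Ω] {P : Measure Ω} [IsProbabilityMeasure P]
    {g : ℕ → Ω → ℝ} (hg : ∀ k, Measurable (g k)) {B : ℝ} (hB : ∀ k ω, |g k ω| ≤ B)
    {D : ℝ} (hvar : ∀ N : ℕ, 1 ≤ N → ∫ ω, ((N : ℝ)⁻¹ * ∑ k ∈ Finset.range N, g k ω) ^ 2 ∂P ≤ D / N) :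
    ∀ᵐ ω ∂P, Tendsto (fun N : ℕ => (N : ℝ)⁻¹ * ∑ k ∈ Finset.range N, g k ω) atTop (𝓝 0) := by
  have hSm : ∀ n, Measurable fun ω => ∑ k ∈ Finset.range n, g k ω := fun n => Finset.measurable_sum _ fun k _ => hg k
  have hSb : ∀ n ω, |∑ k ∈ Finset.range n, g k ω| ≤ n * B := fun n ω =>
    (Finset.abs_sum_le_sum_abs _ _).trans (by
      calc ∑ k ∈ Finset.range n, |g k ω| ≤ ∑ _k ∈ Finset.range n, B := Finset.sum_le_sum fun k _ => hB k ω
        _ = n * B := by rw [Finset.sum_const, Finset.card_range, nsmul_eq_mul])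
  have hD0 : 0 ≤ D := by
    have h := hvar 1 le_rfl
    rw [Nat.cast_one, div_one] at h
    exact le_trans (integral_nonneg fun ω => sq_nonneg _) h
  -- `X n = ((n+1)⁻² S_{(n+1)²})²`
  set X : ℕ → Ω → ℝ := fun n ω => ((((n + 1) ^ 2 : ℕ) : ℝ)⁻¹ * ∑ k ∈ Finset.range ((n + 1) ^ 2), g k ω) ^ 2 with hX
  have hXm : ∀ n, Measurable (X n) := fun n => ((hSm _).const_mul _).pow_const 2
  have hX0 : ∀ n ω, 0 ≤ X n ω := fun n ω => sq_nonneg _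
  have hsq1 : ∀ n : ℕ, 1 ≤ (n + 1) ^ 2 := fun n => Nat.one_le_pow _ _ (Nat.succ_pos n)
  have hTn : ∀ n : ℕ, (0 : ℝ) < (((n + 1) ^ 2 : ℕ) : ℝ) := fun n => by exact_mod_cast hsq1 n
  have hXb : ∀ n ω, X n ω ≤ B ^ 2 := by
    intro n ω
    have h2 : |((((n + 1) ^ 2 : ℕ) : ℝ))⁻¹ * ∑ k ∈ Finset.range ((n + 1) ^ 2), g k ω| ≤ B := by
      rw [abs_mul, abs_inv, abs_of_pos (hTn n)]
      calc ((((n + 1) ^ 2 : ℕ) : ℝ))⁻¹ * |∑ k ∈ Finset.range ((n + 1) ^ 2), g k ω| ≤ ((((n + 1) ^ 2 : ℕ) : ℝ))⁻¹ * ((((n + 1) ^ 2 : ℕ) : ℝ) * B) :=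
            mul_le_mul_of_nonneg_left (hSb _ ω) (inv_nonneg.2 (hTn n).le)
        _ = B := by field_simp
    calc X n ω = |((((n + 1) ^ 2 : ℕ) : ℝ))⁻¹ * ∑ k ∈ Finset.range ((n + 1) ^ 2), g k ω| ^ 2 := by rw [hX, sq_abs]
      _ ≤ B ^ 2 := pow_le_pow_left₀ (abs_nonneg _) h2 2
  have hXi : ∀ n, Integrable (X n) P := fun n =>
    (integrable_const (B ^ 2)).mono' (hXm n).aestronglyMeasurable
      (Eventually.of_forall fun ω => by rw [Real.norm_eq_abs, abs_of_nonneg (hX0 n ω)]; exact hXb n ω)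
  have hEX : ∀ n : ℕ, ∫ ω, X n ω ∂P ≤ D / (((n : ℝ) + 1) ^ 2) := fun n => by
    have h := hvar ((n + 1) ^ 2) (hsq1 n)
    simp only [hX]
    push_cast at h ⊢
    exact h
  have hsum : Summable fun n : ℕ => D / (((n : ℝ) + 1) ^ 2) := by
    have h := (summable_nat_add_iff 1).2 (Real.summable_one_div_nat_pow.2 one_lt_two)
    refine (h.mul_left D).congr fun n => ?_
    push_cast
    ring
  have hlin : ∫⁻ ω, (∑' n, ENNReal.ofReal (X n ω)) ∂P ≠ ∞ := by
    rw [lintegral_tsum fun n => (hXm n).ennreal_ofReal.aemeasurable]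
    refine ne_top_of_le_ne_top (ENNReal.ofReal_ne_top (r := ∑' n : ℕ, D / (((n : ℝ) + 1) ^ 2))) ?_
    rw [ENNReal.ofReal_tsum_of_nonneg (fun n => div_nonneg hD0 (by positivity)) hsum]
    refine ENNReal.tsum_le_tsum fun n => ?_
    rw [← ofReal_integral_eq_lintegral_ofReal (hXi n) (ae_of_all _ (hX0 n))]
    exact ENNReal.ofReal_le_ofReal (hEX n)
  have hae : ∀ᵐ ω ∂P, Tendsto (fun n => X n ω) atTop (𝓝 0) := by
    have h1 := ae_lt_top (Measurable.tsum fun n => (hXm n).ennreal_ofReal) hlin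
    filter_upwards [h1] with ω hω
    have h2 := ENNReal.tendsto_atTop_zero_of_tsum_ne_top hω.ne
    have h3 : Tendsto (fun n => (ENNReal.ofReal (X n ω)).toReal) atTop (𝓝 (0 : ℝ≥0∞).toReal) :=
      (ENNReal.tendsto_toReal ENNReal.zero_ne_top).comp h2
    rw [ENNReal.toReal_zero] at h3
    exact h3.congr fun n => ENNReal.toReal_ofReal (hX0 n ω)
  filter_upwards [hae] with ω hω
  -- `a m = m⁻² S_{m²} → 0`
  set a : ℕ → ℝ := fun m => (((m ^ 2 : ℕ) : ℝ))⁻¹ * ∑ k ∈ Finset.range (m ^ 2), g k ω with ha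
  have haX : ∀ n : ℕ, |a (n + 1)| = Real.sqrt (X n ω) := fun n => by rw [hX, ha, Real.sqrt_sq_eq_abs]
  have ha0 : Tendsto (fun n : ℕ => a (n + 1)) atTop (𝓝 0) := by
    have h1 : Tendsto (fun n => Real.sqrt (X n ω)) atTop (𝓝 (Real.sqrt 0)) := (Real.continuous_sqrt.tendsto 0).comp hω
    rw [Real.sqrt_zero] at h1
    exact squeeze_zero_norm (fun n => by rw [Real.norm_eq_abs, haX n]) h1
  have ha0' : Tendsto a atTop (𝓝 0) := (tendsto_add_atTop_iff_nat 1).1 ha0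
  have herr : Tendsto (fun m : ℕ => |B| * (2 * (m : ℝ) + 1) / (m : ℝ) ^ 2) atTop (𝓝 0) := by
    have h1 : Tendsto (fun m : ℕ => ((m : ℝ))⁻¹) atTop (𝓝 0) := tendsto_inv_atTop_nhds_zero_nat
    have h2 : Tendsto (fun m : ℕ => |B| * (2 * ((m : ℝ))⁻¹ + ((m : ℝ))⁻¹ * ((m : ℝ))⁻¹)) atTop (𝓝 (|B| * (2 * 0 + 0 * 0))) :=
      ((h1.const_mul 2).add (h1.mul h1)).const_mul |B|
    rw [mul_zero, zero_mul, add_zero, mul_zero] at h2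
    refine h2.congr' ?_
    filter_upwards [eventually_ge_atTop 1] with m hm
    have hm0 : (m : ℝ) ≠ 0 := by exact_mod_cast (Nat.one_le_iff_ne_zero.1 hm)
    field_simp
  have hφ : Tendsto (fun m : ℕ => |a m| + |B| * (2 * (m : ℝ) + 1) / (m : ℝ) ^ 2) atTop (𝓝 0) := by
    have h := (tendsto_zero_iff_norm_tendsto_zero.1 ha0').add herr
    rw [add_zero] at h
    simpa [Real.norm_eq_abs] using h
  have hfloor : Tendsto (fun N : ℕ => Nat.sqrt N) atTop atTop := by
    refine tendsto_atTop_atTop.2 fun b => ⟨b ^ 2, fun N hN => Nat.le_sqrt'.2 hN⟩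
  refine squeeze_zero_norm' ?_ (hφ.comp hfloor)
  filter_upwards [eventually_ge_atTop 1] with N hN
  set m : ℕ := Nat.sqrt N with hm
  have hm2le : m ^ 2 ≤ N := Nat.sqrt_le' N
  have hNlt : N < (m + 1) ^ 2 := Nat.lt_succ_sqrt' N
  have hm1 : 1 ≤ m := by rw [hm, Nat.le_sqrt']; simpa using hN
  have hmpos : (0 : ℝ) < (m : ℝ) := by exact_mod_cast hm1
  have hNpos : (0 : ℝ) < (N : ℝ) := by exact_mod_cast hN
  have hm2pos : (0 : ℝ) < (((m ^ 2 : ℕ) : ℝ)) := by positivity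
  -- split the sum at `m²`
  have hsplit : ∑ k ∈ Finset.range N, g k ω = (∑ k ∈ Finset.range (m ^ 2), g k ω) + ∑ k ∈ Finset.Ico (m ^ 2) N, g k ω := by
    rw [← Finset.sum_range_add_sum_Ico _ hm2le]
  have hrest : |∑ k ∈ Finset.Ico (m ^ 2) N, g k ω| ≤ |B| * (2 * (m : ℝ) + 1) := by
    refine (Finset.abs_sum_le_sum_abs _ _).trans ?_
    calc ∑ k ∈ Finset.Ico (m ^ 2) N, |g k ω| ≤ ∑ _k ∈ Finset.Ico (m ^ 2) N, |B| := Finset.sum_le_sum fun k _ => (hB k ω).trans (le_abs_self B)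
      _ = ((N - m ^ 2 : ℕ) : ℝ) * |B| := by rw [Finset.sum_const, Nat.card_Ico, nsmul_eq_mul]
      _ ≤ (2 * (m : ℝ) + 1) * |B| := by
          refine mul_le_mul_of_nonneg_right ?_ (abs_nonneg B)
          have h1 : N - m ^ 2 ≤ 2 * m + 1 := by
            have : (m + 1) ^ 2 = m ^ 2 + (2 * m + 1) := by ring
            omega
          exact_mod_cast h1
      _ = |B| * (2 * (m : ℝ) + 1) := mul_comm _ _
  have hNinv : ((N : ℝ))⁻¹ ≤ (((m ^ 2 : ℕ) : ℝ))⁻¹ := by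
    rw [inv_le_inv₀ hNpos hm2pos]; exact_mod_cast hm2le
  show ‖((N : ℝ))⁻¹ * ∑ k ∈ Finset.range N, g k ω‖ ≤ (fun m : ℕ => |a m| + |B| * (2 * (m : ℝ) + 1) / (m : ℝ) ^ 2) (Nat.sqrt N)
  rw [← hm, Real.norm_eq_abs, hsplit, mul_add, ha]
  refine (abs_add_le _ _).trans (add_le_add ?_ ?_)
  · rw [abs_mul, abs_mul, abs_of_pos (inv_pos.2 hNpos), abs_of_pos (inv_pos.2 hm2pos)]
    exact mul_le_mul_of_nonneg_right hNinv (abs_nonneg _)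
  · rw [abs_mul, abs_of_pos (inv_pos.2 hNpos), div_eq_inv_mul]
    have hcast : (((m ^ 2 : ℕ) : ℝ)) = (m : ℝ) ^ 2 := by push_cast; ring
    rw [← hcast]
    exact mul_le_mul hNinv hrest (abs_nonneg _) (inv_nonneg.2 hm2pos.le)

/-! ## §3. The discretely sampled cold-start chain -/

variable {L : ℕ} [NeZero L]

/-- ★★★ **Mean-square ergodic theorem for discrete samples** (every coupling; `C, c` depend on `L, β'`): for every strong solution `U` from a
deterministic start on any space, every bounded measurable `G` with `|G| ≤ 1`, every sampling step `h > 0` and every `N ≥ 1`,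
`E[(N⁻¹ Σ_(k<N) G(U_(kh)) − ∫ G dμ_(β'))²] ≤ (4 + 4C·e^(−ch)/(1 − e^(−ch)))/N`. [folklore] -/
theorem integral_sq_average_sub_wilson_le (L : ℕ) [NeZero L] (β' : ℝ) :
    ∃ C c : ℝ, 0 < C ∧ 0 < c ∧
      ∀ (x : GaugeConfig 3 L (Matrix.specialUnitaryGroup (Fin 2) ℂ))
        (Ω : Type) [MeasurableSpace Ω] (P : Measure Ω) [IsProbabilityMeasure P]
        (W : ℝ≥0 → Ω → (Edge 3 L × NoiseIdx 2 → ℝ)) (hW : IsFlatBrownian W P)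
        (U : ℝ≥0 → Ω → GaugeConfig 3 L (Matrix.specialUnitaryGroup (Fin 2) ℂ)),
        (∀ ω, U 0 ω = x) →
        (latticeLangevinDynamics (fundamentalLatticeRep 2) β').IsSolution (fundamentalRep (Fin 2)) hW.natFiltration P W U →
        ∀ (G : GaugeConfig 3 L (Matrix.specialUnitaryGroup (Fin 2) ℂ) → ℝ), Measurable G → (∀ z, |G z| ≤ 1) →
        ∀ (h : ℝ≥0), 0 < h → ∀ (N : ℕ), 1 ≤ N →
          ∫ ω, ((N : ℝ)⁻¹ * (∑ k ∈ Finset.range N, G (U ((k : ℝ≥0) * h) ω)) -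
              ∫ z, G z ∂(wilsonMeasure (d := 3) (L := L) (fundamentalRep (Fin 2)) β')) ^ 2 ∂P ≤
            (4 + 4 * C * Real.exp (-c * h) / (1 - Real.exp (-c * h))) / N := by
  classical
  obtain ⟨C, c, hC, hc, h48⟩ := abs_twoTime_centered_le_exp L β'
  refine ⟨C, c, hC, hc, fun x Ω _ P _ W hW U hU0 hU G hG hG1 h hh N hN => ?_⟩
  haveI : IsProbabilityMeasure (wilsonMeasure (d := 3) (L := L) (fundamentalRep (Fin 2)) β') :=
    isProbabilityMeasure_wilsonMeasure (d := 3) (L := L) (fundamentalRep (Fin 2)) (continuous_fundamentalRep (Fin 2)) β'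
  set m : ℝ := ∫ z, G z ∂(wilsonMeasure (d := 3) (L := L) (fundamentalRep (Fin 2)) β') with hm
  have hm1 : |m| ≤ 1 := by
    have hh' := norm_integral_le_of_norm_le_const (μ := wilsonMeasure (d := 3) (L := L) (fundamentalRep (Fin 2)) β') (f := G) (C := 1)
      (Eventually.of_forall fun z => by simpa [Real.norm_eq_abs] using hG1 z)
    simpa [Real.norm_eq_abs] using hh'
  have hmU : ∀ u : ℝ≥0, Measurable (U u) := fun u => (hU.adapted u).mono (hW.natFiltration.le u) le_rfl
  -- the centred samples
  set g : ℕ → Ω → ℝ := fun k ω => G (U ((k : ℝ≥0) * h) ω) - m with hgdef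
  have hgm : ∀ k, Measurable (g k) := fun k => (hG.comp (hmU _)).sub measurable_const
  have hgb : ∀ k ω, |g k ω| ≤ 2 := fun k ω => (abs_sub _ _).trans (by linarith [hG1 (U ((k : ℝ≥0) * h) ω), hm1])
  set r : ℝ := Real.exp (-c * h) with hr
  have hr0 : 0 ≤ r := (Real.exp_pos _).le
  have hr1 : r < 1 := by
    rw [hr, Real.exp_lt_one_iff]
    have : (0 : ℝ) < c * h := mul_pos hc (by exact_mod_cast hh)
    linarith
  -- two-time decay `|E[g_j g_k]| ≤ 2C r^(k−j)`
  have hF : Measurable fun z => (G z - m) / 2 := (hG.sub measurable_const).div_const 2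
  have hF1 : ∀ z, |(G z - m) / 2| ≤ 1 := fun z => by
    rw [abs_div, abs_two]
    have : |G z - m| ≤ 2 := (abs_sub _ _).trans (by linarith [hG1 z, hm1])
    linarith
  have hdec : ∀ j k : ℕ, j ≤ k → |∫ ω, g j ω * g k ω ∂P| ≤ 2 * C * r ^ (k - j) := by
    intro j k hjk
    have ht : ((k : ℝ≥0) * h) = (j : ℝ≥0) * h + ((k - j : ℕ) : ℝ≥0) * h := by
      rw [← add_mul, ← Nat.cast_add, Nat.add_sub_cancel' hjk]
    have h1 := h48 x Ω P W hW U hU0 hU ((j : ℝ≥0) * h) (((k - j : ℕ) : ℝ≥0) * h) (fun z => (G z - m) / 2) G hF hF1 hG hG1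
    rw [← ht] at h1
    have heq : ∫ ω, g j ω * g k ω ∂P = 2 * ∫ ω, (G (U ((j : ℝ≥0) * h) ω) - m) / 2 * (G (U ((k : ℝ≥0) * h) ω) - m) ∂P := by
      rw [← integral_const_mul]
      exact integral_congr_ae (ae_of_all _ fun ω => by simp only [hgdef]; ring)
    have hpow : Real.exp (-c * ((((k - j : ℕ) : ℝ≥0) * h : ℝ≥0) : ℝ)) = r ^ (k - j) := by
      rw [hr, ← Real.exp_nat_mul]; congr 1; rw [NNReal.coe_mul, NNReal.coe_natCast]; ring
    rw [heq, abs_mul, abs_two]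
    calc 2 * |∫ ω, (G (U ((j : ℝ≥0) * h) ω) - m) / 2 * (G (U ((k : ℝ≥0) * h) ω) - m) ∂P|
        ≤ 2 * (C * Real.exp (-c * ((((k - j : ℕ) : ℝ≥0) * h : ℝ≥0) : ℝ))) := mul_le_mul_of_nonneg_left h1 (by norm_num)
      _ = 2 * C * r ^ (k - j) := by rw [hpow]; ring
  have hvar := integral_sq_sum_le_of_twoTime hgm hgb (by positivity : (0 : ℝ) ≤ 2 * C) hr0 hr1 hdec N
  -- centring and normalisation
  have hNpos : (0 : ℝ) < (N : ℝ) := by exact_mod_cast hN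
  have hcent : ∀ ω, (N : ℝ)⁻¹ * (∑ k ∈ Finset.range N, G (U ((k : ℝ≥0) * h) ω)) - m = (N : ℝ)⁻¹ * ∑ k ∈ Finset.range N, g k ω := by
    intro ω
    have hsum : ∑ k ∈ Finset.range N, g k ω = (∑ k ∈ Finset.range N, G (U ((k : ℝ≥0) * h) ω)) - N * m := by
      simp only [hgdef, Finset.sum_sub_distrib, Finset.sum_const, Finset.card_range, nsmul_eq_mul]
    rw [hsum, mul_sub, ← mul_assoc, inv_mul_cancel₀ hNpos.ne', one_mul]
  calc ∫ ω, ((N : ℝ)⁻¹ * (∑ k ∈ Finset.range N, G (U ((k : ℝ≥0) * h) ω)) - m) ^ 2 ∂P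
      = ∫ ω, ((N : ℝ)⁻¹ * ∑ k ∈ Finset.range N, g k ω) ^ 2 ∂P := integral_congr_ae (ae_of_all _ fun ω => by
          show ((N : ℝ)⁻¹ * (∑ k ∈ Finset.range N, G (U ((k : ℝ≥0) * h) ω)) - m) ^ 2 = ((N : ℝ)⁻¹ * ∑ k ∈ Finset.range N, g k ω) ^ 2
          rw [hcent ω])
    _ = (N : ℝ)⁻¹ ^ 2 * ∫ ω, (∑ k ∈ Finset.range N, g k ω) ^ 2 ∂P := by
        rw [← integral_const_mul]; exact integral_congr_ae (ae_of_all _ fun ω => by ring)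
    _ ≤ (N : ℝ)⁻¹ ^ 2 * ((N : ℝ) * (2 ^ 2 + 2 * (2 * C) * r / (1 - r))) := mul_le_mul_of_nonneg_left hvar (by positivity)
    _ = (4 + 4 * C * r / (1 - r)) / N := by field_simp; ring

/-- ★★★ **ALMOST-SURE ERGODIC THEOREM for discrete samples** (every coupling, every start, every realisation): for every strong solution `U` from a
deterministic start on any space, every bounded measurable `G` with `|G| ≤ 1` and every sampling step `h > 0`,
`N⁻¹ Σ_(k<N) G(U_(kh)) → ∫ G dμ_(β')` almost surely. [folklore] -/
theorem ae_tendsto_average_wilson (L : ℕ) [NeZero L] (β' : ℝ)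
    (x : GaugeConfig 3 L (Matrix.specialUnitaryGroup (Fin 2) ℂ))
    {Ω : Type} [MeasurableSpace Ω] {P : Measure Ω} [IsProbabilityMeasure P]
    {W : ℝ≥0 → Ω → (Edge 3 L × NoiseIdx 2 → ℝ)} (hW : IsFlatBrownian W P)
    {U : ℝ≥0 → Ω → GaugeConfig 3 L (Matrix.specialUnitaryGroup (Fin 2) ℂ)} (hU0 : ∀ ω, U 0 ω = x)
    (hU : (latticeLangevinDynamics (fundamentalLatticeRep 2) β').IsSolution (fundamentalRep (Fin 2)) hW.natFiltration P W U)
    {G : GaugeConfig 3 L (Matrix.specialUnitaryGroup (Fin 2) ℂ) → ℝ} (hG : Measurable G) (hG1 : ∀ z, |G z| ≤ 1)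
    {h : ℝ≥0} (hh : 0 < h) :
    ∀ᵐ ω ∂P, Tendsto (fun N : ℕ => (N : ℝ)⁻¹ * ∑ k ∈ Finset.range N, G (U ((k : ℝ≥0) * h) ω)) atTop
      (𝓝 (∫ z, G z ∂(wilsonMeasure (d := 3) (L := L) (fundamentalRep (Fin 2)) β'))) := by
  classical
  haveI : IsProbabilityMeasure (wilsonMeasure (d := 3) (L := L) (fundamentalRep (Fin 2)) β') :=
    isProbabilityMeasure_wilsonMeasure (d := 3) (L := L) (fundamentalRep (Fin 2)) (continuous_fundamentalRep (Fin 2)) β'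
  set m : ℝ := ∫ z, G z ∂(wilsonMeasure (d := 3) (L := L) (fundamentalRep (Fin 2)) β') with hm
  have hm1 : |m| ≤ 1 := by
    have hh' := norm_integral_le_of_norm_le_const (μ := wilsonMeasure (d := 3) (L := L) (fundamentalRep (Fin 2)) β') (f := G) (C := 1)
      (Eventually.of_forall fun z => by simpa [Real.norm_eq_abs] using hG1 z)
    simpa [Real.norm_eq_abs] using hh'
  have hmU : ∀ u : ℝ≥0, Measurable (U u) := fun u => (hU.adapted u).mono (hW.natFiltration.le u) le_rfl
  obtain ⟨C, c, hC, hc, h54⟩ := integral_sq_average_sub_wilson_le L β'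
  set g : ℕ → Ω → ℝ := fun k ω => G (U ((k : ℝ≥0) * h) ω) - m with hgdef
  have hgm : ∀ k, Measurable (g k) := fun k => (hG.comp (hmU _)).sub measurable_const
  have hgb : ∀ k ω, |g k ω| ≤ 2 := fun k ω => (abs_sub _ _).trans (by linarith [hG1 (U ((k : ℝ≥0) * h) ω), hm1])
  have hcent : ∀ (N : ℕ), 1 ≤ N → ∀ ω, (N : ℝ)⁻¹ * (∑ k ∈ Finset.range N, G (U ((k : ℝ≥0) * h) ω)) - m =
      (N : ℝ)⁻¹ * ∑ k ∈ Finset.range N, g k ω := by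
    intro N hN ω
    have hNpos : (0 : ℝ) < (N : ℝ) := by exact_mod_cast hN
    have hsum : ∑ k ∈ Finset.range N, g k ω = (∑ k ∈ Finset.range N, G (U ((k : ℝ≥0) * h) ω)) - N * m := by
      simp only [hgdef, Finset.sum_sub_distrib, Finset.sum_const, Finset.card_range, nsmul_eq_mul]
    rw [hsum, mul_sub, ← mul_assoc, inv_mul_cancel₀ hNpos.ne', one_mul]
  have hvar : ∀ N : ℕ, 1 ≤ N → ∫ ω, ((N : ℝ)⁻¹ * ∑ k ∈ Finset.range N, g k ω) ^ 2 ∂P ≤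
      (4 + 4 * C * Real.exp (-c * h) / (1 - Real.exp (-c * h))) / N := by
    intro N hN
    have h1 := h54 x Ω P W hW U hU0 hU G hG hG1 h hh N hN
    refine le_of_eq_of_le (integral_congr_ae (ae_of_all _ fun ω => ?_)) h1
    show ((N : ℝ)⁻¹ * ∑ k ∈ Finset.range N, g k ω) ^ 2 = ((N : ℝ)⁻¹ * (∑ k ∈ Finset.range N, G (U ((k : ℝ≥0) * h) ω)) - m) ^ 2
    rw [hcent N hN ω]
  have hgen := ae_tendsto_average_zero_of_sq_le hgm hgb hvar
  filter_upwards [hgen] with ω hω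
  have h1 : Tendsto (fun N : ℕ => (N : ℝ)⁻¹ * (∑ k ∈ Finset.range N, G (U ((k : ℝ≥0) * h) ω)) - m) atTop (𝓝 0) := by
    refine hω.congr' ?_
    filter_upwards [eventually_ge_atTop 1] with N hN
    exact (hcent N hN ω).symm
  have h2 := h1.add_const m
  simpa using h2

end Summit.QuantumFields.YangMills.Theorems.ColdStartUniversality

end
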